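import Literature.MathematicalPhysics.QuantumLattice.XYOrderGDProofs
import HarnessLib

/-!
# The XY torus Hamiltonian as a tensor square along a bond plane (plain form, no rotation)

For the spin-`n/2` XY Hamiltonian of the even torus,
`H = xxzHamiltonian n (torusGraph d L) (-1) 0 = -Σ_{⟨xy⟩} (SˣₓSˣᵧ + SʸₓSʸᵧ)`, and a reflection
`θ` through bond planes (`Torus.reflectBetweenSites j a`), we write `H` in the tensor-square
identification `𝓗_Λ ≅ 𝓗_{left} ⊗ 𝓗_{left}` of `XYOrderReflection.lean` (`torusSplit`,
`torusLeftEmbed A = A ⊗ 1`, `torusRightEmbed B = 1 ⊗ B`, the right factor read through `θ`):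

* `xyHalfHamiltonian` — the XY Hamiltonian of the left half with FREE boundary conditions
  (sum over the left bonds);
* `xyTorus_eq_tensorSquare` — `H = H_half ⊗ 1 + 1 ⊗ H_half - Σ_{x ∈ cross} Σ_{α<2} S^α_x ⊗ S^α_x`.

This is the geometric splitting behind reflection positivity (Kennedy–Lieb–Shastry 1988,
eq. (21)), but WITHOUT the sublattice rotation / complex conjugation of the RP argument
(`xyRealFieldHamiltonian_eq_submatrix` is the rotated, real form): it is an identity of operators
in the original frame, which is what the Griffiths–Ginibre positivity arguments
(`XYMessagerMiracleSole.lean`) need. Proof = the bookkeeping of `xyRealFieldHamiltonian_eq_submatrix`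
with the bond `SˣSˣ + SʸSʸ` in place of the rotated bond. No new notion is introduced besides the
free half Hamiltonian.

## References

* T. Kennedy, E. H. Lieb, B. S. Shastry, J. Stat. Phys. 53 (1988) 1019, p. 1027–1028, eq. (21)
  ("three types of bonds"; `H = H^L ⊗ 1 + 1 ⊗ H^R - Σ Mᵢ ⊗ Nᵢ`). [KLS1988JSP]
-/

noncomputable section

open Matrix Finset Literature.Probability.LatticeModels

namespace Literature.MathematicalPhysics.QuantumLattice

variable {d : ℕ}

section HalfHamiltonian

variable (L : ℕ) [NeZero L] (j : Fin d) (a : ZMod L) (hL : Even L) (n : ℕ)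

/-- The XY bond term `SˣₓSˣᵧ + SʸₓSʸᵧ` (symmetrised), on any finite site set. [folklore] -/
def xyBond {Λ : Type*} [Fintype Λ] [DecidableEq Λ] (n : ℕ) (x y : Λ) : Op Λ (n + 1) :=
  spinBond n 0 x y + spinBond n 1 x y

omit [NeZero L] in
/-- `xyBond` is symmetric. [folklore] -/
theorem xyBond_comm {Λ : Type*} [Fintype Λ] [DecidableEq Λ] (n : ℕ) (x y : Λ) :
    xyBond n x y = xyBond n y x := by
  simp only [xyBond, spinBond_comm n _ x y]

/-- **The XY Hamiltonian of the left half with free boundary conditions**: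
`H_half = -Σ_{left bonds ⟨xy⟩} (SˣₓSˣᵧ + SʸₓSʸᵧ)`. Kennedy–Lieb–Shastry, J. Stat. Phys. 53 (1988),
p. 1028 (the left-bond part of `H^L`). [cite: KLS1988JSP, p. 1028] -/
def xyHalfHamiltonian : Op (torusLeftHalf L j a) (n + 1) :=
  -∑ e ∈ torusLeftEdges L j a,
    Sym2.lift ⟨fun x y => xyBond n (torusToLeft L j a hL x) (torusToLeft L j a hL y),
      fun _ _ => xyBond_comm n _ _⟩ e

/-- The XY torus Hamiltonian is `-Σ_{edges}` of the XY bond. [folklore] -/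
theorem xyTorus_eq_neg_sum_xyBond :
    xxzHamiltonian n (torusGraph d L) (-1) 0 =
      -∑ e ∈ (torusGraph d L).edgeFinset,
        Sym2.lift ⟨fun x y => xyBond n x y, fun x y => xyBond_comm n x y⟩ e := by
  unfold xxzHamiltonian
  have hsum : ∀ e ∈ (torusGraph d L).edgeFinset,
      Sym2.lift ⟨fun x y => spinBond (Λ := TorusSite d L) n 0 x y + spinBond n 1 x y +
          ((0 : ℝ) : ℂ) • spinBond n 2 x y, fun x y => by simp only [spinBond_comm]⟩ e =
        Sym2.lift ⟨fun x y => xyBond (Λ := TorusSite d L) n x y, fun x y => xyBond_comm n x y⟩ e := by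
    intro e _
    induction e using Sym2.ind with
    | h x y => simp [xyBond]
  rw [Finset.sum_congr rfl hsum]
  simp

variable {L j a hL}

/-- Pushing an algebra homomorphism through the XY bond. [folklore] -/
theorem map_xyBond {Λ Λ' : Type*} [Fintype Λ] [DecidableEq Λ] [Fintype Λ'] [DecidableEq Λ']
    (n : ℕ) (φ : Op Λ (n + 1) →ₐ[ℂ] Op Λ' (n + 1)) (x y : Λ) :
    φ (xyBond n x y) =
      (1 / 2 : ℂ) • (φ (siteSpin n x 0) * φ (siteSpin n y 0) + φ (siteSpin n y 0) * φ (siteSpin n x 0)) +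
        (1 / 2 : ℂ) • (φ (siteSpin n x 1) * φ (siteSpin n y 1) + φ (siteSpin n y 1) * φ (siteSpin n x 1)) := by
  simp only [xyBond, spinBond, map_add, map_smul, map_mul]

/-- **Left bonds are `b ⊗ 1`.** [cite: KLS1988JSP, eq. (21)] -/
theorem xyBond_eq_torusLeftEmbed (n : ℕ) {x y : TorusSite d L}
    (hx : x ∈ torusLeftHalf L j a) (hy : y ∈ torusLeftHalf L j a) :
    xyBond n x y = torusLeftEmbed L j a hL
      (xyBond n (torusToLeft L j a hL x) (torusToLeft L j a hL y)) := by
  rw [map_xyBond, ← siteSpin_eq_torusLeftEmbed n hx, ← siteSpin_eq_torusLeftEmbed n hy,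
    ← siteSpin_eq_torusLeftEmbed n hx, ← siteSpin_eq_torusLeftEmbed n hy]
  rfl

/-- **Right bonds are `1 ⊗ b`.** [cite: KLS1988JSP, eq. (21)] -/
theorem xyBond_eq_torusRightEmbed (n : ℕ) {z w : TorusSite d L}
    (hz : z ∉ torusLeftHalf L j a) (hw : w ∉ torusLeftHalf L j a) :
    xyBond n z w = torusRightEmbed L j a hL
      (xyBond n (torusToLeft L j a hL z) (torusToLeft L j a hL w)) := by
  rw [map_xyBond, ← siteSpin_eq_torusRightEmbed n hz, ← siteSpin_eq_torusRightEmbed n hw,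
    ← siteSpin_eq_torusRightEmbed n hz, ← siteSpin_eq_torusRightEmbed n hw]
  rfl

/-- **Crossing bonds**: for a left endpoint `x` of a crossing bond `{x, θx}`,
`b(x, θx) = Σ_{α<2} (S^α_x ⊗ 1)(1 ⊗ S^α_x)`. [cite: KLS1988JSP, eqs. (20)–(21)] -/
theorem xyBond_cross (n : ℕ) (x : torusCrossSites L j a) :
    xyBond n (x : TorusSite d L) (Torus.reflectBetweenSites j a x) =
      torusLeftEmbed L j a hL (siteSpin n (torusToLeft L j a hL x) 0) *
          torusRightEmbed L j a hL (siteSpin n (torusToLeft L j a hL x) 0) +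
        torusLeftEmbed L j a hL (siteSpin n (torusToLeft L j a hL x) 1) *
          torusRightEmbed L j a hL (siteSpin n (torusToLeft L j a hL x) 1) := by
  have hx : (x : TorusSite d L) ∈ torusLeftHalf L j a := (mem_torusCrossSites.1 x.2).1
  have hθ : Torus.reflectBetweenSites j a x ∉ torusLeftHalf L j a := fun h =>
    (reflectBetweenSites_mem_torusLeftHalf_iff L j a hL (x : TorusSite d L)).1 h hx
  have e0 : ∀ α : Fin 3, (siteSpin n (x : TorusSite d L) α : Op (TorusSite d L) (n + 1)) =
      torusLeftEmbed L j a hL (siteSpin n (torusToLeft L j a hL x) α) := fun α =>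
    siteSpin_eq_torusLeftEmbed n hx α
  have e2 : ∀ α : Fin 3,
      (siteSpin n (Torus.reflectBetweenSites j a x) α : Op (TorusSite d L) (n + 1)) =
        torusRightEmbed L j a hL (siteSpin n (torusToLeft L j a hL x) α) := fun α => by
    rw [siteSpin_eq_torusRightEmbed n hθ, torusToLeft_reflectBetweenSites]
  set X : Op (torusLeftHalf L j a) (n + 1) := siteSpin n (torusToLeft L j a hL x) 0 with hX
  set Y : Op (torusLeftHalf L j a) (n + 1) := siteSpin n (torusToLeft L j a hL x) 1 with hY
  have hPX : torusLeftEmbed L j a hL X * torusRightEmbed L j a hL X =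
      torusRightEmbed L j a hL X * torusLeftEmbed L j a hL X := by
    rw [torusLeftEmbed_mul_torusRightEmbed, torusRightEmbed_mul_torusLeftEmbed]
  have hPY : torusLeftEmbed L j a hL Y * torusRightEmbed L j a hL Y =
      torusRightEmbed L j a hL Y * torusLeftEmbed L j a hL Y := by
    rw [torusLeftEmbed_mul_torusRightEmbed, torusRightEmbed_mul_torusLeftEmbed]
  simp only [xyBond, spinBond, e0, e2, ← hX, ← hY]
  rw [← hPX, ← hPY]
  simp only [smul_add]
  module

variable (L j a hL)

/-- **The XY torus Hamiltonian as a tensor square along the bond planes of `θ`**: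
`H = H_half ⊗ 1 + 1 ⊗ H_half - Σ_{x ∈ cross} Σ_{α<2} (S^α_x ⊗ 1)(1 ⊗ S^α_x)` (plain frame, no
sublattice rotation; even side `L`). Kennedy–Lieb–Shastry, J. Stat. Phys. 53 (1988), eq. (21).
[cite: KLS1988JSP, eq. (21)] -/
theorem xyTorus_eq_tensorSquare :
    xxzHamiltonian n (torusGraph d L) (-1) 0 =
      torusLeftEmbed L j a hL (xyHalfHamiltonian L j a hL n) +
          torusRightEmbed L j a hL (xyHalfHamiltonian L j a hL n) -
        ∑ x ∈ torusCrossSites L j a, ∑ α : Fin 2,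
          torusLeftEmbed L j a hL (siteSpin n (torusToLeft L j a hL x) (Fin.castSucc α)) *
            torusRightEmbed L j a hL (siteSpin n (torusToLeft L j a hL x) (Fin.castSucc α)) := by
  rw [xyTorus_eq_neg_sum_xyBond, sum_edgeFinset_split L j a hL]
  set TL : Sym2 (TorusSite d L) → Op (torusLeftHalf L j a) (n + 1) := fun e =>
    Sym2.lift ⟨fun x y => xyBond n (torusToLeft L j a hL x) (torusToLeft L j a hL y),
      fun _ _ => xyBond_comm n _ _⟩ e with hTL
  -- (1) left bonds
  have h1 : ∑ e ∈ torusLeftEdges L j a,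
      Sym2.lift ⟨fun x y => xyBond n x y, fun x y => xyBond_comm n x y⟩ e =
        torusLeftEmbed L j a hL (∑ e ∈ torusLeftEdges L j a, TL e) := by
    rw [map_sum]
    refine sum_congr rfl fun e he => ?_
    obtain ⟨-, hl⟩ := mem_filter.1 he
    revert hl
    refine Sym2.ind (fun x y => ?_) e
    intro hl
    simp only [hTL, Sym2.lift_mk]
    exact xyBond_eq_torusLeftEmbed n (hl x (Sym2.mem_mk_left x y)) (hl y (Sym2.mem_mk_right x y))
  -- (2) right bonds
  have h2 : ∑ e ∈ ((torusGraph d L).edgeFinset.filter fun e => ∀ x ∈ e, x ∉ torusLeftHalf L j a),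
      Sym2.lift ⟨fun x y => xyBond n x y, fun x y => xyBond_comm n x y⟩ e =
        torusRightEmbed L j a hL (∑ e ∈ torusLeftEdges L j a, TL e) := by
    rw [← sum_rightEdges_eq_sum_leftEdges L j a hL TL, map_sum]
    · refine sum_congr rfl fun e he => ?_
      obtain ⟨-, hr⟩ := mem_filter.1 he
      revert hr
      refine Sym2.ind (fun x y => ?_) e
      intro hr
      simp only [hTL, Sym2.lift_mk]
      exact xyBond_eq_torusRightEmbed n (hr x (Sym2.mem_mk_left x y))
        (hr y (Sym2.mem_mk_right x y))
    · intro e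
      refine Sym2.ind (fun x y => ?_) e
      simp only [hTL, Sym2.map_mk, Sym2.lift_mk, torusToLeft_reflectBetweenSites]
  -- (3) crossing bonds
  have h3 : ∑ x ∈ torusCrossSites L j a,
      Sym2.lift ⟨fun x y => xyBond n x y, fun x y => xyBond_comm n x y⟩
        s(x, Torus.reflectBetweenSites j a x) =
      ∑ x ∈ torusCrossSites L j a, ∑ α : Fin 2,
          torusLeftEmbed L j a hL (siteSpin n (torusToLeft L j a hL x) (Fin.castSucc α)) *
            torusRightEmbed L j a hL (siteSpin n (torusToLeft L j a hL x) (Fin.castSucc α)) := by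
    rw [← Finset.sum_coe_sort (torusCrossSites L j a), ← Finset.sum_coe_sort (torusCrossSites L j a)]
    refine sum_congr rfl fun x _ => ?_
    rw [Sym2.lift_mk, Fin.sum_univ_two]
    exact xyBond_cross n x
  rw [h1, h2, h3, xyHalfHamiltonian, map_neg, map_neg]
  abel

end HalfHamiltonian

end Literature.MathematicalPhysics.QuantumLattice

end
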